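import Literature.NumberTheory.LFunctions.Zhang2022.RepairTrueBand

/-!
# Zhang (2022) §18-margin repair rung — barrier extension `R⁺⁺`: the true-band slot for the GLUED class
# (`u ⊕ v`: ANY bulk below the wall, overhang `K`-Lipschitz with `‖·‖ ≤ M` on `[1, ∞)`, wall value `v(1) = 0`)

Trunk T-ANT (NumberTheory/LFunctions). Y. Zhang, *Discrete mean estimates and the Landau–Siegel
zero*, arXiv:2211.02515v1 (2022) [Zhang2022LandauSiegel] — **an unrefereed manuscript under
adjudication. WHAT THIS IS NOT: nothing here asserts or denies its Theorems 1–2 or any analytic lemma;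
no claim about Landau–Siegel zeros, about Parity, or about a repaired `Margin232` is made; `DiscMeanTrueBandKM` is an
E*-SLOT (E-004 on the true band, main scale), displayed where used, NEVER asserted.** Cell `landau-siegel`
(rung F-S3), sub-cell E, seat ls-barrier-p2 g2.

`RepairTrueBand.lean` (p470415) closes the wall-zero class of GLOBALLY 1-Lipschitz profiles (`‖g‖ ≤ 1`) from the
true-band slot alone. The B-len / B-multi class texts glue an ARBITRARY in-class bulk `u` (merely `H¹`, several pieces…)
to a smooth overhang `v` with `v(1) = 0` (`Repair.inClass_glue`, p458054): those profiles are `K`-Lipschitz and bounded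
by `M` on `[1, ∞)` only. This file carries the same statement for that class:

* slot `DiscMeanTrueBandKM c′ K M m η := DiscMeanTrueBandOn V_{K,M} c′ m η`, `V_{K,M} g :⇔ g` is `K`-Lipschitz on
  `[1,∞)`, `‖g‖ ≤ M` there, `g(1) = 0` (kind (c); its RHS `η·(discMeanAbs⌈P⌉ + 𝔞𝔓)` carries the design's OWN bulk mean,
  so an arbitrary bulk is priced honestly — cross term by Cauchy–Schwarz; expected true, see p470415's docstring and
  the price note: derivation = formula I beyond the (7.2) support bound, NOT in tree);
* chains `discMean_fromWall_of_trueBandOn_KM` (every `⌈P⌉ ≤ N ≤ ⌈P^{1+δ}⌉`; tail term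
  `𝓛^{−A}·(discMeanAbs(bandEdge) + max(K,M)²·discWeight)` from `discMeanFlat_bandEdge_lipschitzOn`, p470027) and
  `discMean_fromWall_topVanishing_of_trueBandOn_KM` (every `N ≥ ⌈P⌉` for a top-vanishing profile);
* rows `Repair.familySmoothWallZeroTrueBand` (Design `SmoothDesign` (c′,K,M,g); InClass = `SmoothDesign.InClass ∧ g 1 = 0`)
  and `Repair.familySmoothTopWallZeroTrueBand` (Design `SmoothTopDesign`; InClass = `SmoothTopDesign.InClass ∧ g 1 = 0`;
  verdict for EVERY `N ≥ ⌈P⌉`), `_decided`, `rplus_smoothWallZeroTrueBand_decided`;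
* C2: `WallZeroDesign`/`WallZeroTopDesign` members embed with `K = M = 1` (`inClassWall0_ofWallZero(Top)`);
  C4: the glued class-text design `u ⊕ v` with `v(1) = 0` is a member (`inClassWall0_glue`), for ANY bulk `u`.

CURRENCY (REF-E C3(e)): discrete mean; (b) `Re ρ = ½` and (c) the true-band slot displayed.

## References

* Y. Zhang, arXiv:2211.02515v1 (2022), §2 (2.14)–(2.20), (2.30)–(2.31), §7 (7.2) [p. 44], §8 Lemma 8.1.
  [cite: Zhang2022LandauSiegel, §§2, 7, 8]
-/

noncomputable section

open Real Complex
open scoped NNReal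

namespace Literature.NumberTheory.LFunctions.Zhang2022

namespace Repair

/-- The glued wall-zero class with constants `(K, M)`: `K`-Lipschitz and bounded by `M` on `[1, ∞)`, wall value `0`;
NOTHING is asked below the wall. [cite: Zhang2022LandauSiegel, §7 (7.2) p.44] -/
def GluedWallZeroClass (K : ℝ≥0) (M : ℝ) (g : ℝ → ℂ) : Prop :=
  LipschitzOnWith K g (Set.Ici 1) ∧ (∀ z : ℝ, 1 ≤ z → ‖g z‖ ≤ M) ∧ g 1 = 0

/-- **E-004 on the true band for the glued class `(K, M)`** (hypothesis shape; NOT asserted): the true-band slot of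
`RepairTrueBand.lean` over `GluedWallZeroClass K M`. [cite: Zhang2022LandauSiegel, §2 (2.16)–(2.20), (2.30)–(2.31)] -/
def DiscMeanTrueBandKM (c' : ℝ) (K : ℝ≥0) (M : ℝ) (m : ℕ) (η : ℝ) : Prop :=
  DiscMeanTrueBandOn (GluedWallZeroClass K M) c' m η

/-! ### Chains for the class `K`-Lipschitz / `‖·‖ ≤ M` on `[1, ∞)` -/

/-- **From the wall to any length `≤ ⌈P^{1+δ}⌉` for a class `V ⊆` «`K`-Lipschitz and bounded by `M` on `[1, ∞)`»,
conditionally on the true-band slot over `V` only.** [cite: Zhang2022LandauSiegel, §2 (2.16)–(2.20), (2.30); §8 Lemma 8.1] -/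
theorem discMean_fromWall_of_trueBandOn_KM {V : (ℝ → ℂ) → Prop} (c' : ℝ) {δ : ℝ} (hδ : 0 < δ) (A : ℕ)
    {K : ℝ≥0} {M η : ℝ}
    (hV : ∀ g, V g → LipschitzOnWith K g (Set.Ici 1) ∧ ∀ z : ℝ, 1 ≤ z → ‖g z‖ ≤ M)
    (hB : DiscMeanTrueBandOn V c' (1058 + 2 * A) η) :
    Skeleton.ForAllLarge fun D _ χ =>
      (∀ i ∈ Skeleton.idx χ, (i.2).re = 1 / 2) →
        ∀ g : ℝ → ℂ, V g → ∀ N : ℕ, ⌈Skeleton.bigP D⌉₊ ≤ N → N ≤ ⌈Skeleton.bigP D ^ (1 + δ)⌉₊ →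
          |discMean c' χ g N - discMean c' χ g ⌈Skeleton.bigP D⌉₊| ≤
            η * (discMeanAbs c' χ g ⌈Skeleton.bigP D⌉₊ + Skeleton.frakA χ * frakP D) +
              (Skeleton.ell D ^ A)⁻¹ *
                (discMeanAbs c' χ g (bandEdge D (1058 + 2 * A)) + max (K : ℝ) M ^ 2 * discWeight c' χ) := by
  refine ((Skeleton.ForAllLarge.and hB
    (KnifeEdgeInvisibleTail.discMeanFlat_bandEdge_lipschitzOn c' hδ A)).and
      (Skeleton.ForAllLarge.of_le 3 fun D _ _ hD _ _ => hD)).mono ?_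
  intro D _ χ _ _ h hA g hg N hN₁ hN₂
  obtain ⟨⟨hband, hflat⟩, hD3⟩ := h
  have hℓ : 0 ≤ (Skeleton.ell D ^ A)⁻¹ :=
    inv_nonneg.mpr (pow_nonneg (zero_le_one.trans (Skeleton.one_lt_ell hD3).le) A)
  have hT0 : 0 ≤ (Skeleton.ell D ^ A)⁻¹ *
      (discMeanAbs c' χ g (bandEdge D (1058 + 2 * A)) + max (K : ℝ) M ^ 2 * discWeight c' χ) :=
    mul_nonneg hℓ (add_nonneg (Finset.sum_nonneg fun _ _ => mul_nonneg (abs_nonneg _) (sq_nonneg _))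
      (mul_nonneg (sq_nonneg _) (Finset.sum_nonneg fun _ _ => abs_nonneg _)))
  by_cases hNb : N ≤ bandEdge D (1058 + 2 * A)
  · exact (hband hA g hg N hN₁ hNb).trans (le_add_of_nonneg_right hT0)
  · have hNb' : bandEdge D (1058 + 2 * A) ≤ N := (not_le.mp hNb).le
    have hE₁ : ⌈Skeleton.bigP D⌉₊ ≤ bandEdge D (1058 + 2 * A) := ceil_bigP_le_bandEdge hD3 _
    have h1 := hband hA g hg (bandEdge D (1058 + 2 * A)) hE₁ le_rfl
    have h2 := hflat hA g K M (hV g hg).1 (hV g hg).2 (bandEdge D (1058 + 2 * A)) N le_rfl hNb' hN₂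
    calc |discMean c' χ g N - discMean c' χ g ⌈Skeleton.bigP D⌉₊|
        = |(discMean c' χ g (bandEdge D (1058 + 2 * A)) - discMean c' χ g ⌈Skeleton.bigP D⌉₊) +
            (discMean c' χ g N - discMean c' χ g (bandEdge D (1058 + 2 * A)))| := by ring_nf
      _ ≤ |discMean c' χ g (bandEdge D (1058 + 2 * A)) - discMean c' χ g ⌈Skeleton.bigP D⌉₊| +
            |discMean c' χ g N - discMean c' χ g (bandEdge D (1058 + 2 * A))| := abs_add_le _ _
      _ ≤ _ := add_le_add h1 h2

/-- **… and for a top-vanishing profile every `N ≥ ⌈P⌉`** (`g = 0` on `[θ, ∞)`).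
[cite: Zhang2022LandauSiegel, §2 (2.16)–(2.20); §8 Lemma 8.1] -/
theorem discMean_fromWall_topVanishing_of_trueBandOn_KM {V : (ℝ → ℂ) → Prop} (c' : ℝ) (θ : ℝ) (A : ℕ)
    {K : ℝ≥0} {M η : ℝ}
    (hV : ∀ g, V g → LipschitzOnWith K g (Set.Ici 1) ∧ ∀ z : ℝ, 1 ≤ z → ‖g z‖ ≤ M)
    (hB : DiscMeanTrueBandOn V c' (1058 + 2 * A) η) :
    Skeleton.ForAllLarge fun D _ χ =>
      (∀ i ∈ Skeleton.idx χ, (i.2).re = 1 / 2) →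
        ∀ g : ℝ → ℂ, V g → (∀ z, θ ≤ z → g z = 0) → ∀ N : ℕ, ⌈Skeleton.bigP D⌉₊ ≤ N →
          |discMean c' χ g N - discMean c' χ g ⌈Skeleton.bigP D⌉₊| ≤
            η * (discMeanAbs c' χ g ⌈Skeleton.bigP D⌉₊ + Skeleton.frakA χ * frakP D) +
              (Skeleton.ell D ^ A)⁻¹ *
                (discMeanAbs c' χ g (bandEdge D (1058 + 2 * A)) + max (K : ℝ) M ^ 2 * discWeight c' χ) := by
  have hδ : 0 < |θ - 1| + 1 := by have := abs_nonneg (θ - 1); linarith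
  have hθ : θ ≤ 1 + (|θ - 1| + 1) := by have := le_abs_self (θ - 1); linarith
  refine ((discMean_fromWall_of_trueBandOn_KM c' hδ A hV hB).and
      (Skeleton.ForAllLarge.of_le 3 fun D _ _ hD _ _ => hD)).mono ?_
  intro D _ χ _ _ h hA g hg hg0 N hN₁
  obtain ⟨hwall, hD3⟩ := h
  by_cases hNδ : N ≤ ⌈Skeleton.bigP D ^ (1 + (|θ - 1| + 1))⌉₊
  · exact hwall hA g hg N hN₁ hNδ
  · have hNδ' : ⌈Skeleton.bigP D ^ (1 + (|θ - 1| + 1))⌉₊ ≤ N := (not_le.mp hNδ).le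
    have hℓ0 : 0 < Skeleton.ell D := zero_lt_one.trans (Skeleton.one_lt_ell hD3)
    have hP : 0 < Skeleton.bigP D := Real.exp_pos _
    have hlogPpos : 0 < Real.log (Skeleton.bigP D) := by
      rw [Skeleton.bigP, Real.log_exp]; exact pow_pos hℓ0 9
    have hNδ1 : 1 ≤ ⌈Skeleton.bigP D ^ (1 + (|θ - 1| + 1))⌉₊ :=
      Nat.one_le_ceil_iff.mpr (Real.rpow_pos_of_pos hP _)
    have hpoly : ∀ (x : Skeleton.Chr D) (s : ℂ),
        profPoly χ x g N s = profPoly χ x g ⌈Skeleton.bigP D ^ (1 + (|θ - 1| + 1))⌉₊ s := by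
      intro x s
      simp only [profPoly]
      rw [← Finset.sum_Ico_consecutive _ hNδ1 hNδ']
      have hzero : ∑ n ∈ Finset.Ico ⌈Skeleton.bigP D ^ (1 + (|θ - 1| + 1))⌉₊ N,
          Skeleton.pc χ x n * g (Real.log n / Real.log (Skeleton.bigP D)) * (n : ℂ) ^ (-s) = 0 := by
        refine Finset.sum_eq_zero fun n hn => ?_
        have hn : ⌈Skeleton.bigP D ^ (1 + (|θ - 1| + 1))⌉₊ ≤ n := (Finset.mem_Ico.mp hn).1
        have hnr : Skeleton.bigP D ^ (1 + (|θ - 1| + 1)) ≤ (n : ℝ) :=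
          (Nat.le_ceil _).trans (by exact_mod_cast hn)
        have hθn : θ ≤ Real.log n / Real.log (Skeleton.bigP D) := by
          rw [le_div_iff₀ hlogPpos]
          have h1 := Real.log_le_log (Real.rpow_pos_of_pos hP _) hnr
          rw [Real.log_rpow hP] at h1
          calc θ * Real.log (Skeleton.bigP D) ≤ (1 + (|θ - 1| + 1)) * Real.log (Skeleton.bigP D) :=
                mul_le_mul_of_nonneg_right hθ hlogPpos.le
            _ ≤ Real.log n := h1
        rw [hg0 _ hθn]; ring
      rw [hzero, add_zero]
    have hmean : discMean c' χ g N = discMean c' χ g ⌈Skeleton.bigP D ^ (1 + (|θ - 1| + 1))⌉₊ := by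
      simp only [discMean, hpoly]
    rw [hmean]
    have hPle : ⌈Skeleton.bigP D⌉₊ ≤ ⌈Skeleton.bigP D ^ (1 + (|θ - 1| + 1))⌉₊ := by
      refine Nat.ceil_mono ?_
      have hP1 : 1 ≤ Skeleton.bigP D := by
        rw [Skeleton.bigP]; exact Real.one_le_exp (pow_nonneg hℓ0.le 9)
      calc Skeleton.bigP D = Skeleton.bigP D ^ (1:ℝ) := (Real.rpow_one _).symm
        _ ≤ Skeleton.bigP D ^ (1 + (|θ - 1| + 1)) := Real.rpow_le_rpow_of_exponent_le hP1 (by linarith)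
    exact hwall hA g hg _ hPle le_rfl

/-! ### Rows over the smooth design types of p457377, with wall value zero -/

/-- The glued class restricts to «`K`-Lipschitz and bounded by `M` on `[1, ∞)`». [folklore] -/
private theorem gluedClass_restrict (K : ℝ≥0) (M : ℝ) (g : ℝ → ℂ) (hg : GluedWallZeroClass K M g) :
    LipschitzOnWith K g (Set.Ici 1) ∧ ∀ z : ℝ, 1 ≤ z → ‖g z‖ ≤ M := ⟨hg.1, hg.2.1⟩

/-- **Verdict (true band, glued class, bounded lengths)** for a smooth design `(c′, K, M, g)` with `g(1) = 0`.
[cite: Zhang2022LandauSiegel, §2 (2.16)–(2.20), (2.30)–(2.31); §8 Lemma 8.1] -/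
def SmoothDesign.VerdictTrueBand (d : SmoothDesign) : Prop :=
  ∀ ⦃δ : ℝ⦄, 0 < δ → ∀ (A : ℕ) (η : ℝ), DiscMeanTrueBandKM d.c' d.K d.M (1058 + 2 * A) η →
    Skeleton.ForAllLarge fun D _ χ =>
      (∀ i ∈ Skeleton.idx χ, (i.2).re = 1 / 2) →
        ∀ N : ℕ, ⌈Skeleton.bigP D⌉₊ ≤ N → N ≤ ⌈Skeleton.bigP D ^ (1 + δ)⌉₊ →
          ¬ (η * (discMeanAbs d.c' χ d.g ⌈Skeleton.bigP D⌉₊ + Skeleton.frakA χ * frakP D) +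
                (Skeleton.ell D ^ A)⁻¹ *
                  (discMeanAbs d.c' χ d.g (bandEdge D (1058 + 2 * A)) + max (d.K : ℝ) d.M ^ 2 * discWeight d.c' χ) <
              |discMean d.c' χ d.g N - discMean d.c' χ d.g ⌈Skeleton.bigP D⌉₊|)

/-- The slice theorem (glued class, bounded lengths). [cite: Zhang2022LandauSiegel, §2 (2.16)–(2.20); §8 Lemma 8.1] -/
theorem SmoothDesign.verdictTrueBand_of_inClassWall0 (d : SmoothDesign) (h : d.InClass) (h0 : d.g 1 = 0) :
    d.VerdictTrueBand := by
  intro δ hδ A η hB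
  refine (discMean_fromWall_of_trueBandOn_KM d.c' hδ A (gluedClass_restrict d.K d.M) hB).mono ?_
  intro D _ χ _ _ hflat hA N hN₁ hN₂
  exact not_lt.2 (hflat hA d.g ⟨h.1, h.2, h0⟩ N hN₁ hN₂)

/-- family «smooth design (any bulk, `K`-Lipschitz `‖·‖ ≤ M` overhang), wall value zero, from the wall to any bounded
length, TRUE-BAND slot displayed». [cite: Zhang2022LandauSiegel, §2 (2.16)–(2.20), (2.30); §8 Lemma 8.1] -/
def familySmoothWallZeroTrueBand : DesignFamily where
  Design := SmoothDesign
  InClass d := d.InClass ∧ d.g 1 = 0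
  Verdict := SmoothDesign.VerdictTrueBand

/-- **`familySmoothWallZeroTrueBand` is decided.** [cite: Zhang2022LandauSiegel, §2 (2.16)–(2.20); §8 Lemma 8.1] -/
theorem familySmoothWallZeroTrueBand_decided : familySmoothWallZeroTrueBand.Decided :=
  fun d h => SmoothDesign.verdictTrueBand_of_inClassWall0 d h.1 h.2

/-- **Verdict (true band, glued class, top-vanishing, full polynomial)**: every `N ≥ ⌈P⌉`.
[cite: Zhang2022LandauSiegel, §2 (2.16)–(2.20), (2.30)–(2.31)] -/
def SmoothTopDesign.VerdictTrueBand (d : SmoothTopDesign) : Prop :=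
  ∀ (A : ℕ) (η : ℝ), DiscMeanTrueBandKM d.c' d.K d.M (1058 + 2 * A) η →
    Skeleton.ForAllLarge fun D _ χ =>
      (∀ i ∈ Skeleton.idx χ, (i.2).re = 1 / 2) →
        ∀ N : ℕ, ⌈Skeleton.bigP D⌉₊ ≤ N →
          ¬ (η * (discMeanAbs d.c' χ d.g ⌈Skeleton.bigP D⌉₊ + Skeleton.frakA χ * frakP D) +
                (Skeleton.ell D ^ A)⁻¹ *
                  (discMeanAbs d.c' χ d.g (bandEdge D (1058 + 2 * A)) + max (d.K : ℝ) d.M ^ 2 * discWeight d.c' χ) <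
              |discMean d.c' χ d.g N - discMean d.c' χ d.g ⌈Skeleton.bigP D⌉₊|)

/-- The slice theorem (glued class, top-vanishing). [cite: Zhang2022LandauSiegel, §2 (2.16)–(2.20); §8 Lemma 8.1] -/
theorem SmoothTopDesign.verdictTrueBand_of_inClassWall0 (d : SmoothTopDesign) (h : d.InClass) (h0 : d.g 1 = 0) :
    d.VerdictTrueBand := by
  intro A η hB
  refine (discMean_fromWall_topVanishing_of_trueBandOn_KM d.c' d.θ A (gluedClass_restrict d.K d.M) hB).mono ?_
  intro D _ χ _ _ hflat hA N hN₁
  exact not_lt.2 (hflat hA d.g ⟨h.1.1, h.1.2, h0⟩ h.2 N hN₁)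

/-- family «smooth top-vanishing design (any bulk), wall value zero, full polynomial vs bulk, TRUE-BAND slot displayed».
[cite: Zhang2022LandauSiegel, §2 (2.16)–(2.20), (2.30); §8 Lemma 8.1] -/
def familySmoothTopWallZeroTrueBand : DesignFamily where
  Design := SmoothTopDesign
  InClass d := d.InClass ∧ d.g 1 = 0
  Verdict := SmoothTopDesign.VerdictTrueBand

/-- **`familySmoothTopWallZeroTrueBand` is decided.** [cite: Zhang2022LandauSiegel, §2 (2.16)–(2.20); §8 Lemma 8.1] -/
theorem familySmoothTopWallZeroTrueBand_decided : familySmoothTopWallZeroTrueBand.Decided :=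
  fun d h => SmoothTopDesign.verdictTrueBand_of_inClassWall0 d h.1 h.2

/-! ### C2 / C4 -/

/-- C2: a wall-value-zero design of p459259 is a member with `K = M = 1`. [cite: Zhang2022LandauSiegel, §7 (7.2) p.44] -/
theorem inClassWall0_ofWallZero (d : WallZeroDesign) (h : d.InClass) :
    familySmoothWallZeroTrueBand.InClass (SmoothDesign.mk d.c' 1 1 d.g) :=
  ⟨⟨h.1.lipschitzOnWith, fun z _ => h.2.1 z⟩, h.2.2⟩

/-- C2 (top): a top-vanishing wall-value-zero design of p459259 is a member with `K = M = 1`.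
[cite: Zhang2022LandauSiegel, §7 (7.2) p.44] -/
theorem inClassWall0_ofWallZeroTop (d : WallZeroTopDesign) (h : d.InClass) :
    familySmoothTopWallZeroTrueBand.InClass (SmoothTopDesign.mk ⟨d.c', 1, 1, d.g⟩ d.θ) :=
  ⟨⟨⟨h.1.1.lipschitzOnWith, fun z _ => h.1.2.1 z⟩, h.2⟩, h.1.2.2⟩

/-- **C4: the glued class-text design `u ⊕ v` is a member, for ANY bulk `u`** (no hypothesis below the wall), when the
overhang `v` is `K`-Lipschitz with `‖v‖ ≤ M` on `[1, θ]`, `v(1) = 0` (wall value zero) and `v(θ) = 0` (top).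
[cite: Zhang2022LandauSiegel, §7 (7.2) p.44] -/
theorem inClassWall0_glue (c' : ℝ) {θ : ℝ} (hθ : 1 ≤ θ) (u v : ℝ → ℂ) {K : ℝ≥0} {M : ℝ}
    (hv : LipschitzOnWith K v (Set.Icc 1 θ)) (hM : ∀ z ∈ Set.Icc 1 θ, ‖v z‖ ≤ M) (hwall : v 1 = 0)
    (htop : v θ = 0) :
    familySmoothTopWallZeroTrueBand.InClass
      (SmoothTopDesign.mk ⟨c', K, M, fun z => if z < 1 then u z else v (min z θ)⟩ θ) := by
  refine ⟨inClass_glue c' hθ u v hv hM htop, ?_⟩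
  show (if (1:ℝ) < 1 then u 1 else v (min 1 θ)) = 0
  rw [if_neg (lt_irrefl _), min_eq_left hθ, hwall]

/-- **`R⁺⁺`-step of this file**: `ClassDecided (Rplus ++ [familySmoothWallZeroTrueBand, familySmoothTopWallZeroTrueBand])`.
[cite: Zhang2022LandauSiegel, §2 (2.32)–(2.33); §7 (7.2) p.44] -/
theorem rplus_smoothWallZeroTrueBand_decided :
    ClassDecided (Rplus ++ [familySmoothWallZeroTrueBand, familySmoothTopWallZeroTrueBand]) :=
  classDecided_append.2
    ⟨rplus_decided, classDecided_cons familySmoothWallZeroTrueBand_decided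
      (classDecided_cons familySmoothTopWallZeroTrueBand_decided classDecided_nil)⟩

end Repair

end Literature.NumberTheory.LFunctions.Zhang2022
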